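import Literature.AnabelianGeometry.SemiGraphs.ChartFibreInjective
import Literature.AnabelianGeometry.SemiGraphs.Prop36HypothesesWitness
import HarnessLib

/-!
# Non-vacuity certificate: the [SemiAnbd] Prop. 3.6 (i)(ii)(iii) pipeline runs end-to-end on a witness

PROOF-ONLY (abc-iut L3, B7 lineage): the tree's inhabitant of `Prop36Hypotheses` (`exists_prop36Hypotheses`,
`Prop36HypothesesWitness.lean`, abc-iut-w5-d212) fed through `prop36_iii_temperedPi` (`ChartFibreInjective.lean`)
— so there EXISTS, kernel-checked, a graph of anabelioids `𝒢` with its constructed tempered fundamental group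
`π₁^temp(𝒢) = 𝒢.temperedPi h36` (Prop. 3.6 (i)), chart `B^temp(𝒢) ≌ B^temp(π₁^temp(𝒢))` (Prop. 3.6 (ii)) and
an INJECTIVE profinite-completion map `π₁^temp(𝒢) ↪ Aut Φ = π̂₁(B(𝒢))` onto a dense subgroup (Prop. 3.6 (iii)):
the hypotheses of the chain are jointly satisfiable and its conclusion is not vacuous.
Mochizuki, *Semi-graphs of anabelioids*, Publ. RIMS **42** (2006), Prop. 3.6 p. 38 [cite: MochizukiSemiAnbd2006, Prop 3.6 p.38].
Nothing here takes a side on [IUTchIII] Cor. 3.12.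
-/

noncomputable section

namespace Literature.AnabelianGeometry.SemiGraphs

open CategoryTheory CategoryTheory.Limits CategoryTheory.PreGaloisCategory
open Literature.AnabelianGeometry.Anabelioids

namespace ProfiniteSemiGraph

/-- **End-to-end non-vacuity of [SemiAnbd] Prop. 3.6 (i)–(iii) as kernel-checked in the tree**: there is a
graph of anabelioids `𝒢` satisfying `Prop36Hypotheses` (the tree's witness) for which — with `π₁^temp(𝒢)` THE
constructed tempered group `𝒢.temperedPi h36` and its chart `𝒢.temperedPiChart h36` — the chart basepoint `Φ`
is a fibre functor of `B(𝒢.toAnab)` and `chartActionFin : π₁^temp(𝒢) → Aut Φ` is an injective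
profinite-completion map (`IsProfiniteCompletion`). [cite: MochizukiSemiAnbd2006, Prop 3.6 p.38] -/
theorem exists_witness_prop36_iii_temperedPi :
    ∃ (𝒢 : ProfiniteSemiGraph.{0}) (h36 : 𝒢.Prop36Hypotheses),
      letI := 𝒢.toAnab.preGaloisCategory_bObj
      ∃ hfin : ∀ X : 𝒢.toAnab.BObj,
          Finite ((chartFibre (𝒢.temperedPiChart h36) (isTempered_of_isFinite_of_prop36 h36)).obj X),
        Nonempty (FiberFunctor
          (chartFibreFin (𝒢.temperedPiChart h36) (isTempered_of_isFinite_of_prop36 h36) hfin)) ∧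
        IsProfiniteCompletion
          ({ toMonoidHom :=
               chartActionFin (𝒢.temperedPiChart h36) (isTempered_of_isFinite_of_prop36 h36) hfin,
             continuous_toFun :=
               continuous_chartActionFin (𝒢.temperedPiChart h36)
                 (isTempered_of_isFinite_of_prop36 h36) hfin } :
            𝒢.temperedPi h36 →ₜ*
              Aut (chartFibreFin (𝒢.temperedPiChart h36) (isTempered_of_isFinite_of_prop36 h36) hfin)) ∧
        Function.Injective
          (chartActionFin (𝒢.temperedPiChart h36) (isTempered_of_isFinite_of_prop36 h36) hfin) := by
  obtain ⟨𝒢, h36⟩ := exists_prop36Hypotheses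
  exact ⟨𝒢, h36, prop36_iii_temperedPi h36⟩

end ProfiniteSemiGraph

end Literature.AnabelianGeometry.SemiGraphs

end
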